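import Literature.MathematicalPhysics.QuantumFieldTheory.Balaban1983to89.B13BlockBondReadingNumerals

/-!
# `Balaban1983to89.B13BondAveragingReadingNumerals` — T. Bałaban, *Renormalization group approach to lattice gauge field theories. II. Cluster expansions*,
# Commun. Math. Phys. **116** (1988) 1–22 [Balaban1988RG2Cluster], (2.5)–(2.7) pp. 12–13, p. 15 (kernels localised at points of the unit torus, decay
# `e^{−δ d(x,x′)}`); *Propagators and renormalization transformations for lattice gauge theories. I*, Commun. Math. Phys. **95** (1984) 17–40
# [Balaban1984PropagatorsI], (1.6)–(1.7) p. 18 (blocks `B(y)`, straight contours `[x, x(c)]`), (1.18) p. 20 (`(Q_k A)(b) = Σ_{x ∈ B^k(b₋)} L^{−k(d+1)} A([x, x(b)])`);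
# *… II*, Commun. Math. Phys. **96** (1984) 223–250 [Balaban1984PropagatorsII], (2.18)–(2.20) p. 226 (`Q`, `Q*`, the multiplication operator `a`), (2.46)
# p. 231; *Propagators for lattice gauge theories in a background field*, Commun. Math. Phys. **99** (1985) 389–434 [Balaban1985BackgroundPropagators],
# (3.12)–(3.13) p. 392 (`Q(U)`, `Q*(U)`), (3.26) p. 395 (`Q*(U)aQ(U)`), Thm 3.10 (3.107)–(3.108) p. 416: ★ THE BOND-AVERAGING RANGE NUMERALS `hD ∕ hD′` OF THE
# N10 PENCIL MODULES AS NUMBERS, THE INDEX-BOND READING THAT GOES WITH A SITE READING, AND MODULE 76's AVERAGING-LINK BINDER `hℓq` AS A NUMBER.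

COMPANION of dag-n10-w6's `B13SiteReadingNumerals` (the SITE reading `fineReadingY`) and this seat's `B13BlockBondReadingNumerals` (the BLOCK and FINE-BOND
readings `blkReadingY ∕ bondReadingY` with `hfibB hfibF hℓQ hℓQs hℓG hℓD hℓp` as numbers).  The bond-sector pencil modules of the N10 lane — 75
`B13OpsYPencilDeltaALocal`, 76 `B13OpsYPencilDeltaALetters` (§4 ★★ `rawEntryLetters_toMatrix_localDeltaA_prodCfg`, §5, §6), `B13OpsYPencilAveraging`, and
dag-n10-w2's `B13GreenCentreDecayOfCoercive` — display, about NODE 00's bond averaging `Q(U) ∕ Q*(U)` ((3.12)–(3.13); flat kernels `qK ∕ qsK`, the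
transporters run from the index bond's base point `embIter j y₋` to the fine bond's source `f₋`), TWO KINDS OF BINDERS this file turns into numbers:
* the AVERAGING-RANGE binders `hD : ∀ ι b, qK ι b ≠ 0 → Site.tdist (embIter j(ι) ι₋) b₋ ≤ D` and `hD′` (the same for `qsK b ι ≠ 0`) — the number of
  transport steps the size letter pays for (`K₀^D`): §2 proves them with **`D_Q := (d+2)·(L^k − 1)`** ([3] (1.18): a fine bond with `q_y(f) ≠ 0` is a bond
  `[x + te_μ, x + (t+1)e_μ]` of a straight contour issuing from a site `x` of the block `B^j(y₋)`, `t < L^j` — the tree's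
  `B6Ineq2142KLevelV1.exists_of_qwt_ne_zero`; the base point `embIter j y₋` lies in the same block, `(d+1)(L^j − 1)` steps, plus the run, `≤ L^j − 1` steps);
* the AVERAGING-LINK range binder `hℓq : ∀ b ι ι′ b′, qsK b ι ≠ 0 → aK ι ι′ ≠ 0 → qK ι′ b′ ≠ 0 → d₁(ℓF b, ℓF b′) ≤ s` of 76 §2∕§4 (the range of `Q*(U)aQ(U)` read
  through a fine-bond reading `ℓF` into [13]'s unit torus), which 76's `linkReading_of_readings` derives from an INDEX-BOND reading `ℓI : IBondY i → UT Nf`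
  and three numerals `hQs ∕ ha ∕ hQ`: §3 supplies the index-bond reading that goes with a site reading `ℓ` — an index bond is read AT ITS BASE POINT
  `embIter j y₋` (NODE 00's transport origin, `Node00.qT`) — and proves `hQ ∕ hQs` with `s₁ = D_Q` (§2 through the exact dictionary
  `d₁(ℓ z, ℓ w) = |chart⁻¹ z − chart⁻¹ w|₁` of `B13BlockBondReadingNumerals`), `ha` with `s₂ = 0` (NODE 00's weight `a` is a DIAGONAL matrix,
  `Node00.aK_eq_diagonal`), hence ★★ `hℓq` with **`s = 2·D_Q`**; §4 instantiates at dag-n10-w6's `fineReadingY` ∕ this seat's `bondReadingY`.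
With this file every NODE-00 reading ∕ averaging binder of 76 §4 is a number or a tree theorem BY NAME: `hℓp` (`B13BlockBondReadingNumerals.hℓp_bondReadingY`,
`2`), `hℓq` (here, `2·D_Q`), `hD ∕ hD′` (here, `D_Q`), `hcQ` (`B9Eq3104CommutatorSizesAvg.sum_abs_qK_eq_one`: `c_Q = 1`), `hcQs`
(`B9Thm310CommutatorBound389B.sum_abs_qsK_le`: `c_{Q*} ≤ 2`), `hca` (here: `Σ_{ι′} |a(ι,ι′)| = w_ι`, NODE 00's printed weight, §2); what stays displayed there
is the background's size `K₀`, the curl incidence numerals `c₁ c₂ N_b` and the basis numerals `cb cl`.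

[folklore] lattice-torus bookkeeping (`ZMod.val`, integer division, the ℓ¹ step distance `Site.tdist`) over NODE 00's `rfl`-level kernels
(`qK = toMatrix′(onFun Q)`, `qsK = qKᵀ`, `aK = diagonal w`) and the typed support fact `B6Ineq2142KLevelV1.exists_of_qwt_ne_zero` of r03∕p22's `Q`;
kernel-checked; TWO SMALL DEFINITIONS (`ibondReadingOf`, `ibondReadingY` — readings only: no operator, no carrier, no instance, no notation); NOTHING of
NODE 00's ∕ pv27's ∕ dag-n10-w6's ∕ the lane's files is modified; nothing here is a claim about the Yang–Mills mass gap; no node is discharged; count-neutral.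

WHY THIS FILE (cell `pub-ymgap`, HUMAN RULING D-0062 ∕ D-0149, Track A node N10 = [B13]; WIDTH SEAT `pub-ymgap-dag-n10-w4` g5, CLAIM-1 ∕ INTENT-1 (R455 (A),
bus line I.32102) = the natural item X3 worded in this seat's HANDOFF §g4 (t1), extended by the `hD ∕ hD′` numerals no tree theorem discharged; lane
owner dag-n10-c's RESIDUAL CENSUS v18 «displayed binder classes»).  WHETHER the N10 term of record reads its index bonds this way is NODE 00's ∕ def-T's
word (census item 2) — NOT claimed here; these are LOCATED INSTANCES showing 75∕76's averaging binders jointly inhabited with explicit numbers.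

WHAT THIS FILE PROVES (all `theorem`s unless marked `def`; `i : KIdx` def-Y's index, `L = ℓ + 1`, `k = i.k`, dimension `d + 1`; `ℓS : SiteY i → UT Nf` any
site reading, `hval` = label-faithful, `hNf : N₀ = Nf`).
* §1 [folklore] torus steps on `T^{(0)}`: `tdist_runSite_le` (`|x − (x + te_μ)|₁ ≤ t`), `tdist_le_of_mem_iterBlock₂` (two sites of ONE block `B^j(y)`:
  `≤ (d+1)(L^j − 1)`), `embIter_mem_iterBlock'` (the base point lies in its block), ★ `tdist_embIter_le_of_mem_iterBlock`, ★ `tdist_embIter_runSite_le`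
  (`x ∈ B^j(y)`, `t < L^j` ⇒ `|embIter j y − (x + te_μ)|₁ ≤ (d+2)(L^j − 1)`).
* §2 NODE 00's bond-averaging kernels: `qK_eq_qwt` (the `Q`-entry IS r03's weight `q_y(f)`), ★ `exists_run_of_qK_ne_zero` ([3] (1.18): the support of
  `q_y` is the set of bonds of the straight contours from `B^j(y₋)`), `hD_qK_level` (level-sharp: `≤ (d+2)(L^{j(ι)} − 1)`), ★★ `hD_qK` ∕ ★★ `hD'_qsK` —
  75∕76's `hD ∕ hD′` WITH THE NUMBER `D_Q = (d+2)(L^k − 1)` —, `aK_apply` (`a(ι,ι′) = [ι = ι′]·w_ι`), `eq_of_aK_ne_zero`, ★ `sum_abs_aK_eq` (76's `hca` row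
  sum `= w_ι`), `hca_of_weight_le`.
* §3 THE INDEX-BOND READING `def ibondReadingOf ℓ : IBondY i → UT Nf` (at the base point `embIter j y₋`): ★ `tdist1_ibondReadingOf_bondReadingOf`
  (dictionary: `d₁(ℓI ι, ℓF f) = |embIter j ι₋ − f₋|₁`, cast equality), `tdist1_ibondReadingOf_eq`, ★ `hQ_ibondReadingOf` ∕ `hQs_ibondReadingOf` (76's `hQ ∕ hQs`
  with `s₁ = D_Q`), ★ `ha_ibondReadingOf` (`s₂ = 0`), ★★ `hℓq_bondReadingOf` (76 §4's `hℓq` with `s = 2·D_Q`).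
* §4 ★ AT dag-n10-w6's `fineReadingY` (p611691) and this seat's `bondReadingY` (p612491): `def ibondReadingY`, `ibondReadingY_apply`,
  `tdist1_ibondReadingY_bondReadingY`, ★ `hQ_ibondReadingY` ∕ `hQs_ibondReadingY` ∕ `ha_ibondReadingY`, ★★ `hℓq_bondReadingY` (`≤ 2(d+2)(L^k − 1)`), and the
  reading-free ★★ `hD_qK` ∕ `hD'_qsK` of §2 serve 76 §4∕§5∕§6 at `ℓB := bondReadingY` verbatim.
HONEST FRAMING: located instances + [folklore] arithmetic; finite-lattice numbers at the coarsest scale (one fine step = torus distance `1`; `D_Q` is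
NOT optimised — the sharp reach of a `j`-level stencil is `(d+1)(L^j − 1) + (L^j − 1)` from the block's far corner, and print's decay constants absorb it
into `O(1)`); nothing of Bałaban's asserted; N06 ∕ N10 NOT discharged; K1⁷ NOT closed; counts unmoved (typed 28∕28 · discharged 5∕27); 0 `sorry`, 0
instance, 0 notation, standard axioms; one finite 𝕋⁴ programme at fixed ε — R4 closes the conditional finite-𝕋⁴ rung `BalabanLadder.UV` only; the YM
mass gap (Clay) is NOT proved by any of this; nothing continuum ∕ ℝ⁴ ∕ OS.

References: T. Bałaban, CMP 116 (1988) 1–22 [Balaban1988RG2Cluster] (2.5)–(2.7) pp.12–13, p.15; CMP 95 (1984) 17–40 [Balaban1984PropagatorsI] (1.6)–(1.7)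
p.18, (1.18) p.20; CMP 96 (1984) 223–250 [Balaban1984PropagatorsII] (2.1)–(2.4) p.224, (2.18)–(2.20) p.226, (2.46) p.231; CMP 99 (1985) 389–434
[Balaban1985BackgroundPropagators] (3.12)–(3.13) p.392, (3.26) p.395, (3.107)–(3.108) p.416; CMP 109 (1987) 249–301 [Balaban1987RG1] (0.1) p.251 (the
centre embedding `T^{(j)} ⊂ T_η`).
-/

noncomputable section

namespace Literature.MathematicalPhysics.QuantumFieldTheory.Balaban1983to89.B13BondAveragingReadingNumerals

open Finset
open Literature.MathematicalPhysics.QuantumFieldTheory.Balaban1983to89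
open Literature.MathematicalPhysics.QuantumFieldTheory.Balaban1983to89.LatticeFieldCalculus (runSite runBond)
open Literature.MathematicalPhysics.QuantumFieldTheory.Balaban1983to89.B6KLevelCensusIndexV1 (KIdx)
open Literature.MathematicalPhysics.QuantumFieldTheory.Balaban1983to89.B6GlobalChartV1 (PV boxEquiv)
open Literature.MathematicalPhysics.QuantumFieldTheory.Balaban1983to89.B5Eq118OneStroke (iterBlockOf iterBlock mem_iterBlock mem_iterBlock_iff)
open Literature.MathematicalPhysics.QuantumFieldTheory.Balaban1983to89.B15DeterminingSets (embIter)
open Literature.MathematicalPhysics.QuantumFieldTheory.Balaban1983to89.B6Ineq2142KLevelV1 (qwt exists_of_qwt_ne_zero lvl_le lvl_le_mK)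
open Literature.MathematicalPhysics.QuantumFieldTheory.Balaban1983to89.B6Ineq2133TwoScaleV1 (onFun_apply)
open Literature.MathematicalPhysics.QuantumFieldTheory.Balaban1983to89.B5TorusCover (UT)
open Literature.MathematicalPhysics.QuantumFieldTheory.Balaban1983to89.B9Thm37GlueTorus (tdist1 tdist1_self tdist1_comm tdist1_triangle)
open Literature.MathematicalPhysics.QuantumFieldTheory.Balaban1983to89.Node00 (SiteY FBondY IBondY toKT qK qsK aK qsK_eq_transpose aK_eq_diagonal)
open Literature.MathematicalPhysics.QuantumFieldTheory.Balaban1983to89.B13SiteReadingNumerals (fineReadingY fineReadingY_val)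
open Literature.MathematicalPhysics.QuantumFieldTheory.Balaban1983to89.B13BlockBondReadingNumerals
  (tdist_le_of_div_eq tdist1_eq_tdist_chart_of_val bondReadingOf bondReadingY bondReadingY_apply)

/-! ## §1. [folklore] torus steps on the finest lattice: runs, blocks, and the base point of a block -/

section Kernel

variable {P : Params}

/-- kernel: the least-absolute-value residue measures the torus distance of one coordinate. [folklore] -/
private theorem natAbs_valMinAbs_eq_min {n : ℕ} [NeZero n] (a : ZMod n) : a.valMinAbs.natAbs = min a.val (-a).val := by
  -- adapted from `B3Taylor310LocalRemainder` §0
  rw [ZMod.valMinAbs_natAbs_eq_min, ZMod.neg_val]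
  split_ifs with h
  · subst h; simp
  · rfl

/-- kernel: the ℓ¹ torus step distance satisfies the triangle inequality (public homonym `B3Taylor310LocalRemainder.tdist_triangle`, not imported to keep
the closure light; coordinatewise `ZMod.natAbs_valMinAbs_add_le`). [folklore] -/
private theorem tdist_triangle' {j : ℕ} (x y z : Site P j) : Site.tdist x z ≤ Site.tdist x y + Site.tdist y z := by
  -- adapted from `B3Taylor310LocalRemainder.tdist_triangle`
  have e : ∀ (u v : Site P j), Site.tdist u v = ∑ μ : Fin P.d, ((u μ - v μ).valMinAbs).natAbs := by
    intro u v
    unfold Site.tdist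
    exact Finset.sum_congr rfl fun μ _ => by rw [natAbs_valMinAbs_eq_min, neg_sub]
  rw [e, e, e, ← Finset.sum_add_distrib]
  refine Finset.sum_le_sum fun μ _ => ?_
  have h : x μ - z μ = (x μ - y μ) + (y μ - z μ) := by ring
  rw [h]
  exact (ZMod.natAbs_valMinAbs_add_le _ _).trans (Int.natAbs_add_le _ _)

/-- kernel: symmetry of the ℓ¹ torus step distance. [folklore] -/
private theorem tdist_comm' {j : ℕ} (x y : Site P j) : Site.tdist x y = Site.tdist y x := by
  unfold Site.tdist
  exact Finset.sum_congr rfl fun μ _ => min_comm _ _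

/-- A STRAIGHT RUN OF `t` STEPS: `|x − (x + te_μ)|₁ ≤ t` (the straight contour `[x, x(c)]` of (1.7)). [cite: Balaban1984PropagatorsI, (1.7) p.18, bookkeeping] -/
theorem tdist_runSite_le {j : ℕ} (x : Site P j) (μ : Fin P.d) (t : ℕ) : Site.tdist x (runSite x μ t) ≤ t := by
  unfold Site.tdist LatticeFieldCalculus.runSite
  have h1 : ∀ ν : Fin P.d,
      min (x ν - Function.update x μ (x μ + t) ν).val (Function.update x μ (x μ + t) ν - x ν).val ≤ if ν = μ then t else 0 := by
    intro ν
    by_cases h : ν = μ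
    · subst h
      simp only [Function.update_self, add_sub_cancel_left, if_true]
      refine (min_le_right _ _).trans ?_
      rw [ZMod.val_natCast]
      exact Nat.mod_le _ _
    · simp [h]
  calc ∑ ν : Fin P.d, min (x ν - Function.update x μ (x μ + t) ν).val (Function.update x μ (x μ + t) ν - x ν).val
      ≤ ∑ ν : Fin P.d, (if ν = μ then t else 0) := Finset.sum_le_sum fun ν _ => h1 ν
    _ = t := by simp

/-- TWO SITES OF ONE BLOCK `B^j(y)` ARE WITHIN `(d+1)(L^j − 1)` STEPS (the block is the cube of side `L^j` over `y`, `B5Eq118OneStroke.mem_iterBlock_iff`;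
standing range `j ≤ m + K`). [cite: Balaban1984PropagatorsI, (1.6) p.18, (1.18) p.20, bookkeeping] -/
theorem tdist_le_of_mem_iterBlock₂ {j : ℕ} (hj : j ≤ P.m + P.K) {y : Site P j} {x x' : Site P 0} (hx : x ∈ iterBlock j y) (hx' : x' ∈ iterBlock j y) :
    Site.tdist x x' ≤ P.d * (P.L ^ j - 1) := by
  rw [mem_iterBlock_iff hj] at hx hx'
  exact tdist_le_of_div_eq (pow_pos P.L_pos j) fun μ => (hx μ).trans (hx' μ).symm

/-- kernel: the base-point embedding is a section of the block map, `iterBlockOf j (embIter j y) = y` (public homonyms `Node00.iterBlockOf_embIter` in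
`OpsYSectELetters`, `B9CubeIndexBondsNearH.iterBlockOf_embIter'`, not imported). [folklore] -/
private theorem iterBlockOf_embIter'' : ∀ (j : ℕ), j ≤ P.m + P.K → ∀ y : Site P j, iterBlockOf j (embIter j y) = y
  | 0, _, _ => rfl
  | j + 1, hj, y => by
    -- adapted from `Node00.OpsYSectELetters.iterBlockOf_embIter`
    show blockOf (iterBlockOf j (embIter j (emb y))) = y
    rw [iterBlockOf_embIter'' j (by omega) (emb y), Site.blockOf_emb hj]

/-- THE BASE POINT LIES IN ITS BLOCK: `embIter j y ∈ B^j(y)` ([I] p. 251: the lattice of centres; standing range). [cite: Balaban1987RG1, (0.1) p.251; Balaban1984PropagatorsI, (1.18) p.20, bookkeeping] -/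
theorem embIter_mem_iterBlock' {j : ℕ} (hj : j ≤ P.m + P.K) (y : Site P j) : embIter j y ∈ iterBlock j y :=
  (mem_iterBlock _ _ _).2 (iterBlockOf_embIter'' j hj y)

/-- ★ A SITE OF THE BLOCK `B^j(y)` IS WITHIN `(d+1)(L^j − 1)` STEPS OF THE BASE POINT `embIter j y`. [cite: Balaban1984PropagatorsI, (1.6) p.18, (1.18) p.20; Balaban1987RG1, (0.1) p.251, bookkeeping] -/
theorem tdist_embIter_le_of_mem_iterBlock {j : ℕ} (hj : j ≤ P.m + P.K) {y : Site P j} {x : Site P 0} (hx : x ∈ iterBlock j y) :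
    Site.tdist (embIter j y) x ≤ P.d * (P.L ^ j - 1) :=
  tdist_le_of_mem_iterBlock₂ hj (embIter_mem_iterBlock' hj y) hx

/-- ★ THE REACH OF A STRAIGHT CONTOUR FROM THE BLOCK: for `x ∈ B^j(y)` and `t < L^j`, `|embIter j y − (x + te_μ)|₁ ≤ (d+2)(L^j − 1)` (block leg + run).
[cite: Balaban1984PropagatorsI, (1.7) p.18, (1.18) p.20 («x ∈ B^k(b₋)», «x(b) is a point in B^k(b₊)»), bookkeeping] -/
theorem tdist_embIter_runSite_le {j : ℕ} (hj : j ≤ P.m + P.K) {y : Site P j} {x : Site P 0} (hx : x ∈ iterBlock j y) (μ : Fin P.d) {t : ℕ}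
    (ht : t < P.L ^ j) : Site.tdist (embIter j y) (runSite x μ t) ≤ (P.d + 1) * (P.L ^ j - 1) := by
  have h1 := tdist_embIter_le_of_mem_iterBlock hj hx
  have h2 := tdist_runSite_le x μ t
  have h3 := tdist_triangle' (embIter j y) x (runSite x μ t)
  have h4 : t ≤ P.L ^ j - 1 := Nat.le_sub_one_of_lt ht
  calc Site.tdist (embIter j y) (runSite x μ t) ≤ P.d * (P.L ^ j - 1) + (P.L ^ j - 1) := by omega
    _ = (P.d + 1) * (P.L ^ j - 1) := by ring

end Kernel

/-! ## §2. NODE 00's bond-averaging kernels `qK ∕ qsK` and the weight `aK`: support and the range numeral `D_Q = (d+2)(L^k − 1)` -/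

section Averaging

variable {d ℓ : ℕ} {hd : 1 ≤ d + 1} {hL : Odd (ℓ + 1) ∧ 1 < ℓ + 1} {b₀ b₁ : ℝ}
variable (i : KIdx d ℓ hd hL b₀ b₁)

/-- NODE 00's `Q`-entry IS r03's averaging weight `q_y(f)` of the member (public homonyms `B9Eq3132Ineq2142Covariant.qK_apply`,
`B9CubeBondRowAgreementNearH.qK_apply'`, not imported). [cite: Balaban1984PropagatorsI, (1.18) p.20; Balaban1985BackgroundPropagators, (3.12) p.392, dictionary] -/
theorem qK_eq_qwt (ι : IBondY i) (f : FBondY i) : qK i ι f = qwt i.hN i.D i.hk ι f := by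
  rw [qK, LinearMap.toMatrix'_apply, onFun_apply]
  rfl

/-- ★ **THE SUPPORT OF `Q(y, ·)`** ([3] (1.18)): `q_y(f) ≠ 0 ⟹ f = [x + te_μ, x + (t+1)e_μ]` for a site `x ∈ B^j(y₋)` and `t < L^j`, `μ` the direction of `y`
(`B6Ineq2142KLevelV1.exists_of_qwt_ne_zero` BY NAME). [cite: Balaban1984PropagatorsI, (1.18) p.20; Balaban1985BackgroundPropagators, (3.12) p.392] -/
theorem exists_run_of_qK_ne_zero {ι : IBondY i} {f : FBondY i} (h : qK i ι f ≠ 0) :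
    ∃ x ∈ iterBlock (ι.1.1 : ℕ) ι.1.2.src, ∃ t < (ℓ + 1) ^ (ι.1.1 : ℕ), runBond x ι.1.2.dir t = f := by
  rw [qK_eq_qwt] at h
  exact exists_of_qwt_ne_zero i.hN i.D i.hk ι h

/-- `hD` LEVEL-SHARP: `q_y(f) ≠ 0 ⟹ |embIter j(y) y₋ − f₋|₁ ≤ (d+2)(L^{j(y)} − 1)`. [cite: Balaban1984PropagatorsI, (1.18) p.20; Balaban1985BackgroundPropagators, (3.12) p.392, (3.108) p.416] -/
theorem hD_qK_level {ι : IBondY i} {f : FBondY i} (h : qK i ι f ≠ 0) :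
    Site.tdist (embIter (ι.1.1 : ℕ) ι.1.2.src) f.src ≤ (d + 2) * ((ℓ + 1) ^ (ι.1.1 : ℕ) - 1) := by
  obtain ⟨x, hx, t, ht, rfl⟩ := exists_run_of_qK_ne_zero i h
  exact tdist_embIter_runSite_le (P := PV d ℓ i.m i.K hd hL) (lvl_le_mK i.hN i.D i.hk ι) hx ι.1.2.dir ht

/-- ★★ **75∕76's AVERAGING-RANGE BINDER `hD` AS A NUMBER**: `qK ι b ≠ 0 ⟹ Site.tdist (embIter j(ι) ι₋) b₋ ≤ D_Q`, **`D_Q = (d+2)·(L^k − 1)`** — EXACTLY the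
binder `hD` of `B13OpsYPencilDeltaALocal.norm_localDeltaA_prodCfg_le` ∕ `B13OpsYPencilDeltaALetters.rawEntryLetters_toMatrix_localDeltaA_prodCfg` ∕
`B13OpsYPencilAveraging` ∕ `B13GreenCentreDecayOfCoercive`. [cite: Balaban1984PropagatorsI, (1.18) p.20; Balaban1985BackgroundPropagators, (3.12) p.392, (3.107)–(3.108) p.416; Balaban1988RG2Cluster, (2.5) p.12] -/
theorem hD_qK : ∀ (ι : IBondY i) (b : FBondY i), qK i ι b ≠ 0 → Site.tdist (embIter (ι.1.1 : ℕ) ι.1.2.src) b.src ≤ (d + 2) * ((ℓ + 1) ^ i.k - 1) :=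
  fun ι _ h => (hD_qK_level i h).trans
    (Nat.mul_le_mul_left _ (Nat.sub_le_sub_right (Nat.pow_le_pow_right (Nat.succ_pos ℓ) (lvl_le i.hN i.D i.hk ι)) 1))

/-- ★★ **… AND `hD′`** (`Q*`'s kernel is the transpose, `Node00.qsK_eq_transpose`): `qsK b ι ≠ 0 ⟹ Site.tdist (embIter j(ι) ι₋) b₋ ≤ (d+2)(L^k − 1)`.
[cite: Balaban1985BackgroundPropagators, (3.13) p.392, (3.108) p.416; Balaban1984PropagatorsII, (2.18) p.226; Balaban1984PropagatorsI, (1.18) p.20] -/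
theorem hD'_qsK : ∀ (b : FBondY i) (ι : IBondY i), qsK i b ι ≠ 0 → Site.tdist (embIter (ι.1.1 : ℕ) ι.1.2.src) b.src ≤ (d + 2) * ((ℓ + 1) ^ i.k - 1) := by
  intro b ι h
  rw [qsK_eq_transpose, Matrix.transpose_apply] at h
  exact hD_qK i ι b h

/-- NODE 00's weight matrix, entrywise: `a(ι, ι′) = [ι = ι′]·w_ι` (`Node00.aK_eq_diagonal`). [cite: Balaban1984PropagatorsII, (2.18)–(2.20) p.226 («a multiplication operator»), dictionary] -/
theorem aK_apply (ι ι' : IBondY i) : aK i ι ι' = if ι = ι' then i.w ι else 0 := by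
  rw [aK_eq_diagonal, Matrix.diagonal_apply]

/-- an averaging link has both ends at ONE index bond: `a(ι, ι′) ≠ 0 ⟹ ι = ι′`. [cite: Balaban1984PropagatorsII, (2.18)–(2.20) p.226, bookkeeping] -/
theorem eq_of_aK_ne_zero {ι ι' : IBondY i} (h : aK i ι ι' ≠ 0) : ι = ι' := by
  by_contra hne
  exact h (by rw [aK_apply, if_neg hne])

/-- ★ **76's WEIGHT ROW SUM `hca` AS NODE 00's PRINTED WEIGHT**: `Σ_{ι′} |a(ι, ι′)| = w_ι` (`w_ι > 0`, `KIdx.hw`). [cite: Balaban1984PropagatorsII, (2.18)–(2.20) p.226 («a_j(L^jη)^{−2}»); Balaban1985BackgroundPropagators, (3.26) p.395] -/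
theorem sum_abs_aK_eq (ι : IBondY i) : ∑ ι', |aK i ι ι'| = i.w ι := by
  classical
  rw [Finset.sum_eq_single ι]
  · rw [aK_apply, if_pos rfl, abs_of_pos (i.hw ι)]
  · intro ι' _ hne
    rw [aK_apply, if_neg (Ne.symm hne), abs_zero]
  · intro h; exact absurd (Finset.mem_univ ι) h

/-- 76's `hca` from ONE bound on the printed weights: `w_ι ≤ c_a` for all `ι` ⟹ `Σ_{ι′} |a(ι, ι′)| ≤ c_a`. [cite: Balaban1984PropagatorsII, (2.18)–(2.20) p.226; Balaban1985BackgroundPropagators, (3.26) p.395, bookkeeping] -/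
theorem hca_of_weight_le {ca : ℝ} (h : ∀ ι, i.w ι ≤ ca) : ∀ ι, ∑ ι', |aK i ι ι'| ≤ ca := fun ι => by
  rw [sum_abs_aK_eq]; exact h ι

/-- the range numeral cast to `ℝ`: `((d+2)(L^k − 1) : ℕ) = (d+2)·(L^k − 1)` in `ℝ`. [cite: Balaban1984PropagatorsII, (2.1) p.224, bookkeeping] -/
theorem cast_rangeQ : (((d + 2) * ((ℓ + 1) ^ i.k - 1) : ℕ) : ℝ) = ((d : ℝ) + 2) * ((((ℓ + 1) ^ i.k : ℕ) : ℝ) - 1) := by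
  have h2 : (1 : ℕ) ≤ (ℓ + 1) ^ i.k := Nat.one_le_pow _ _ (Nat.succ_pos ℓ)
  rw [Nat.cast_mul, Nat.cast_sub h2]
  push_cast
  ring

end Averaging

/-! ## §3. The INDEX-BOND reading that goes with a site reading: an index bond read at its base point -/

section IndexBonds

variable {d ℓ : ℕ} {hd : 1 ≤ d + 1} {hL : Odd (ℓ + 1) ∧ 1 < ℓ + 1} {b₀ b₁ : ℝ}
variable (i : KIdx d ℓ hd hL b₀ b₁)
variable {Nf : Fin (d + 1) → ℕ} (ℓS : SiteY i → UT Nf)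

/-- **THE INDEX-BOND READING THAT GOES WITH A SITE READING `ℓ`**: an index bond `y = ⟨j, b⟩ ∈ 𝔅` is read at its BASE POINT `embIter j b₋ ∈ T_η` (NODE 00's
transport origin for `Q(U)`, `Node00.qT`; print: the coarse bond's initial point `y`). [cite: Balaban1988RG2Cluster, (2.5) p.12; Balaban1985BackgroundPropagators, (3.12) p.392; Balaban1984PropagatorsII, (2.3) p.224, dictionary] -/
def ibondReadingOf (ι : IBondY i) : UT Nf := ℓS (boxEquiv i.hN (embIter (ι.1.1 : ℕ) ι.1.2.src))

variable [∀ μ, NeZero (Nf μ)]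

/-- ★ **THE DICTIONARY FOR AN AVERAGING LEG**: `d₁(ℓI ι, ℓF f) = |embIter j ι₋ − f₋|₁` (cast EQUALITY; label-faithful `ℓ`, `Nf = N₀`; `ℓF` = the fine-bond
reading `bondReadingOf ℓ` of `B13BlockBondReadingNumerals`). [cite: Balaban1984PropagatorsII, (2.1) p.224, (2.46) p.231; Balaban1988RG2Cluster, (2.5) p.12, dictionary] -/
theorem tdist1_ibondReadingOf_bondReadingOf (hNf : ∀ μ, (toKT i).NB μ = Nf μ)
    (hval : ∀ (z : SiteY i) (μ : Fin (d + 1)), (((UT.toSite Nf (ℓS z)) μ).val : ℤ) = z.1 μ) (ι : IBondY i) (f : FBondY i) :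
    tdist1 Nf (ibondReadingOf i ℓS ι) (bondReadingOf i ℓS f) = (Site.tdist (embIter (ι.1.1 : ℕ) ι.1.2.src) f.src : ℝ) := by
  show tdist1 Nf (ℓS (boxEquiv i.hN (embIter (ι.1.1 : ℕ) ι.1.2.src))) (ℓS (boxEquiv i.hN f.src)) = _
  rw [tdist1_eq_tdist_chart_of_val i ℓS hNf hval, Equiv.symm_apply_apply, Equiv.symm_apply_apply]

/-- the dictionary between two index bonds: `d₁(ℓI ι, ℓI ι′) = |embIter j ι₋ − embIter j′ ι′₋|₁`. [cite: Balaban1984PropagatorsII, (2.46) p.231; Balaban1988RG2Cluster, (2.5) p.12, dictionary] -/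
theorem tdist1_ibondReadingOf_eq (hNf : ∀ μ, (toKT i).NB μ = Nf μ)
    (hval : ∀ (z : SiteY i) (μ : Fin (d + 1)), (((UT.toSite Nf (ℓS z)) μ).val : ℤ) = z.1 μ) (ι ι' : IBondY i) :
    tdist1 Nf (ibondReadingOf i ℓS ι) (ibondReadingOf i ℓS ι') =
      (Site.tdist (embIter (ι.1.1 : ℕ) ι.1.2.src) (embIter (ι'.1.1 : ℕ) ι'.1.2.src) : ℝ) := by
  show tdist1 Nf (ℓS (boxEquiv i.hN _)) (ℓS (boxEquiv i.hN _)) = _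
  rw [tdist1_eq_tdist_chart_of_val i ℓS hNf hval, Equiv.symm_apply_apply, Equiv.symm_apply_apply]

/-- ★ **76's `hQ` AS A NUMBER**: `qK ι b ≠ 0 ⟹ d₁(ℓI ι, ℓF b) ≤ D_Q = (d+2)(L^k − 1)`. [cite: Balaban1988RG2Cluster, (2.5) p.12, p.15; Balaban1985BackgroundPropagators, (3.12) p.392, (3.108) p.416; Balaban1984PropagatorsI, (1.18) p.20] -/
theorem hQ_ibondReadingOf (hNf : ∀ μ, (toKT i).NB μ = Nf μ)
    (hval : ∀ (z : SiteY i) (μ : Fin (d + 1)), (((UT.toSite Nf (ℓS z)) μ).val : ℤ) = z.1 μ) :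
    ∀ (ι : IBondY i) (b : FBondY i), qK i ι b ≠ 0 →
      tdist1 Nf (ibondReadingOf i ℓS ι) (bondReadingOf i ℓS b) ≤ ((d : ℝ) + 2) * ((((ℓ + 1) ^ i.k : ℕ) : ℝ) - 1) := by
  intro ι b h
  rw [tdist1_ibondReadingOf_bondReadingOf i ℓS hNf hval, ← cast_rangeQ i]
  exact_mod_cast hD_qK i ι b h

/-- ★ **76's `hQs` AS A NUMBER**: `qsK b ι ≠ 0 ⟹ d₁(ℓF b, ℓI ι) ≤ (d+2)(L^k − 1)`. [cite: Balaban1988RG2Cluster, (2.5) p.12; Balaban1985BackgroundPropagators, (3.13) p.392, (3.108) p.416; Balaban1984PropagatorsII, (2.18) p.226] -/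
theorem hQs_ibondReadingOf (hNf : ∀ μ, (toKT i).NB μ = Nf μ)
    (hval : ∀ (z : SiteY i) (μ : Fin (d + 1)), (((UT.toSite Nf (ℓS z)) μ).val : ℤ) = z.1 μ) :
    ∀ (b : FBondY i) (ι : IBondY i), qsK i b ι ≠ 0 →
      tdist1 Nf (bondReadingOf i ℓS b) (ibondReadingOf i ℓS ι) ≤ ((d : ℝ) + 2) * ((((ℓ + 1) ^ i.k : ℕ) : ℝ) - 1) := by
  intro b ι h
  rw [tdist1_comm, tdist1_ibondReadingOf_bondReadingOf i ℓS hNf hval, ← cast_rangeQ i]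
  exact_mod_cast hD'_qsK i b ι h

omit [∀ μ, NeZero (Nf μ)] in
/-- ★ **76's `ha` AS A NUMBER — ZERO**: the weight is diagonal, so an averaging link's middle leg has length `d₁(ℓI ι, ℓI ι′) ≤ 0`.
[cite: Balaban1984PropagatorsII, (2.18)–(2.20) p.226; Balaban1985BackgroundPropagators, (3.26) p.395; Balaban1988RG2Cluster, (2.5) p.12] -/
theorem ha_ibondReadingOf [∀ μ, NeZero (Nf μ)] :
    ∀ (ι ι' : IBondY i), aK i ι ι' ≠ 0 → tdist1 Nf (ibondReadingOf i ℓS ι) (ibondReadingOf i ℓS ι') ≤ 0 := by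
  intro ι ι' h
  rw [eq_of_aK_ne_zero i h, tdist1_self]

/-- ★★ **MODULE 76 §4's AVERAGING-LINK BINDER `hℓq` AS A NUMBER**: through the fine-bond reading `ℓF = bondReadingOf ℓ` of a label-faithful site reading,
`qsK(b,ι) ≠ 0`, `aK(ι,ι′) ≠ 0`, `qK(ι′,b′) ≠ 0 ⟹ d₁(ℓF b, ℓF b′) ≤ 2·(d+2)(L^k − 1)` (torus triangle inequality through `ℓI ι = ℓI ι′`; the shape
`s₁ + s₂ + s₁` of 76's `linkReading_of_readings` with `s₁ = D_Q`, `s₂ = 0`). [cite: Balaban1985BackgroundPropagators, (3.12)–(3.13) p.392, (3.26) p.395, (3.107)–(3.108) p.416; Balaban1988RG2Cluster, (2.5) p.12, p.15; Balaban1984PropagatorsI, (1.18) p.20] -/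
theorem hℓq_bondReadingOf (hNf : ∀ μ, (toKT i).NB μ = Nf μ)
    (hval : ∀ (z : SiteY i) (μ : Fin (d + 1)), (((UT.toSite Nf (ℓS z)) μ).val : ℤ) = z.1 μ) :
    ∀ (b : FBondY i) (ι ι' : IBondY i) (b' : FBondY i), qsK i b ι ≠ 0 → aK i ι ι' ≠ 0 → qK i ι' b' ≠ 0 →
      tdist1 Nf (bondReadingOf i ℓS b) (bondReadingOf i ℓS b') ≤ 2 * (((d : ℝ) + 2) * ((((ℓ + 1) ^ i.k : ℕ) : ℝ) - 1)) := by
  intro b ι ι' b' h1 h2 h3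
  have e : ι = ι' := eq_of_aK_ne_zero i h2
  subst e
  calc tdist1 Nf (bondReadingOf i ℓS b) (bondReadingOf i ℓS b')
      ≤ tdist1 Nf (bondReadingOf i ℓS b) (ibondReadingOf i ℓS ι) + tdist1 Nf (ibondReadingOf i ℓS ι) (bondReadingOf i ℓS b') :=
        tdist1_triangle _ _ _
    _ ≤ ((d : ℝ) + 2) * ((((ℓ + 1) ^ i.k : ℕ) : ℝ) - 1) + ((d : ℝ) + 2) * ((((ℓ + 1) ^ i.k : ℕ) : ℝ) - 1) :=
        add_le_add (hQs_ibondReadingOf i ℓS hNf hval b ι h1) (hQ_ibondReadingOf i ℓS hNf hval ι b' h3)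
    _ = 2 * (((d : ℝ) + 2) * ((((ℓ + 1) ^ i.k : ℕ) : ℝ) - 1)) := by ring

end IndexBonds

/-! ## §4. ★ The instances at dag-n10-w6's fine reading `fineReadingY` (p611691) and this seat's `bondReadingY` (p612491) -/

section Fine

variable {d ℓ : ℕ} {hd : 1 ≤ d + 1} {hL : Odd (ℓ + 1) ∧ 1 < ℓ + 1} {b₀ b₁ : ℝ}
variable (i : KIdx d ℓ hd hL b₀ b₁) {Nf : Fin (d + 1) → ℕ}

/-- **THE INDEX-BOND READING OF RECORD FOR THESE INSTANCES**: dag-n10-w6's fine reading of the index bond's base point (`ℓI := fineReadingY ∘ chart ∘ embIter ∘ src`).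
[cite: Balaban1988RG2Cluster, (2.5) p.12; Balaban1985BackgroundPropagators, (3.12) p.392, dictionary] -/
def ibondReadingY (hNf : ∀ μ, (toKT i).NB μ = Nf μ) : IBondY i → UT Nf := ibondReadingOf i (fineReadingY i hNf)

/-- `ℓI ι = ℓ_fine (chart (embIter j ι₋))`. [cite: Balaban1985BackgroundPropagators, (3.12) p.392, bookkeeping] -/
theorem ibondReadingY_apply (hNf : ∀ μ, (toKT i).NB μ = Nf μ) (ι : IBondY i) :
    ibondReadingY i hNf ι = fineReadingY i hNf (boxEquiv i.hN (embIter (ι.1.1 : ℕ) ι.1.2.src)) := rfl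

variable [∀ μ, NeZero (Nf μ)]

/-- ★ the dictionary at the readings of record: `d₁(ℓI ι, ℓF f) = |embIter j ι₋ − f₋|₁`. [cite: Balaban1984PropagatorsII, (2.46) p.231; Balaban1988RG2Cluster, (2.5) p.12, dictionary] -/
theorem tdist1_ibondReadingY_bondReadingY (hNf : ∀ μ, (toKT i).NB μ = Nf μ) (ι : IBondY i) (f : FBondY i) :
    tdist1 Nf (ibondReadingY i hNf ι) (bondReadingY i hNf f) = (Site.tdist (embIter (ι.1.1 : ℕ) ι.1.2.src) f.src : ℝ) :=
  tdist1_ibondReadingOf_bondReadingOf i _ hNf (fineReadingY_val i hNf) ι f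

/-- ★ **76's `hQ` AT THE READINGS OF RECORD with `s₁ = (d+2)(L^k − 1)`.** [cite: Balaban1988RG2Cluster, (2.5) p.12, p.15; Balaban1985BackgroundPropagators, (3.12) p.392, (3.108) p.416] -/
theorem hQ_ibondReadingY (hNf : ∀ μ, (toKT i).NB μ = Nf μ) :
    ∀ (ι : IBondY i) (b : FBondY i), qK i ι b ≠ 0 →
      tdist1 Nf (ibondReadingY i hNf ι) (bondReadingY i hNf b) ≤ ((d : ℝ) + 2) * ((((ℓ + 1) ^ i.k : ℕ) : ℝ) - 1) :=
  hQ_ibondReadingOf i _ hNf (fineReadingY_val i hNf)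

/-- ★ **… `hQs`.** [cite: Balaban1988RG2Cluster, (2.5) p.12; Balaban1985BackgroundPropagators, (3.13) p.392, (3.108) p.416] -/
theorem hQs_ibondReadingY (hNf : ∀ μ, (toKT i).NB μ = Nf μ) :
    ∀ (b : FBondY i) (ι : IBondY i), qsK i b ι ≠ 0 →
      tdist1 Nf (bondReadingY i hNf b) (ibondReadingY i hNf ι) ≤ ((d : ℝ) + 2) * ((((ℓ + 1) ^ i.k : ℕ) : ℝ) - 1) :=
  hQs_ibondReadingOf i _ hNf (fineReadingY_val i hNf)

/-- ★ **… and `ha` (`s₂ = 0`).** [cite: Balaban1984PropagatorsII, (2.18)–(2.20) p.226; Balaban1988RG2Cluster, (2.5) p.12] -/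
theorem ha_ibondReadingY (hNf : ∀ μ, (toKT i).NB μ = Nf μ) :
    ∀ (ι ι' : IBondY i), aK i ι ι' ≠ 0 → tdist1 Nf (ibondReadingY i hNf ι) (ibondReadingY i hNf ι') ≤ 0 :=
  ha_ibondReadingOf i _

/-- ★★ **MODULE 76 §4's `hℓq` AT THE READINGS OF RECORD with `s = 2·(d+2)(L^k − 1)`** — next to `B13BlockBondReadingNumerals.hℓp_bondReadingY` (`2`) and §2's
`hD_qK ∕ hD'_qsK` this serves `rawEntryLetters_toMatrix_localDeltaA_prodCfg` ∕ `…deltaAY…` ∕ `…GAY…_of_projection` at `ℓB := bondReadingY i hNf` verbatim.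
[cite: Balaban1985BackgroundPropagators, (3.12)–(3.13) p.392, (3.26) p.395, (3.107)–(3.108) p.416; Balaban1988RG2Cluster, (2.5) p.12, p.15; Balaban1984PropagatorsI, (1.18) p.20] -/
theorem hℓq_bondReadingY (hNf : ∀ μ, (toKT i).NB μ = Nf μ) :
    ∀ (b : FBondY i) (ι ι' : IBondY i) (b' : FBondY i), qsK i b ι ≠ 0 → aK i ι ι' ≠ 0 → qK i ι' b' ≠ 0 →
      tdist1 Nf (bondReadingY i hNf b) (bondReadingY i hNf b') ≤ 2 * (((d : ℝ) + 2) * ((((ℓ + 1) ^ i.k : ℕ) : ℝ) - 1)) :=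
  hℓq_bondReadingOf i _ hNf (fineReadingY_val i hNf)

end Fine

end Literature.MathematicalPhysics.QuantumFieldTheory.Balaban1983to89.B13BondAveragingReadingNumerals

end
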